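import Summits.QuantumAdvantage.AdviceFreeQNC0.LogDegreeResidueBalance
import HarnessLib

/-!
# Cell qa-qnc0 (rung F-Q1, route RingFrame, crux α, line `product`): the EQUIDISTRIBUTION form of the
# PLDAMS ladder implies a uniform MOD₃-character correlation bound (the ceiling of the equi form)

A bookkeeping lemma that locates the planner's ladder (HOME/qa-qnc0-p1/TARGET.md §18, Sketch5
`PLDAMSAt`, `PLDAMSLogEqui`) against the printed log-degree correlation barrier (qn-lit LIT-MEMO-11 §1).

* `norm_sum_omega3_pow_le_of_balanced`: if a finite `B ⊆ {0,1}ⁿ` meets every class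
  `{|u| ≡ r (mod 3)}` in at least `(1/3 − ε)·#B` points, then `‖Σ_{u∈B} ω^{|u|}‖ ≤ 6ε·#B`.
* `norm_charSum_le_of_equidistributed`: consequently, if at some `(n, d)` EVERY `g ∈ lowDeg 𝔽₂ n d`
  has `(1/3 − ε)`-balanced support classes (the shape of the tree theorem `pldamsLogEqui`, rung 0 of the
  ladder), then every `p ∈ lowDeg 𝔽₂ n d` has uniform character correlation
  `‖Σ_u (−1)^{p(u)} ω^{|u|}‖ ≤ 6ε·2ⁿ` — apply the hypothesis to `p` and to `1 + p`.

Why this matters (print status, LIT-MEMO-11 §1): for the uniform character sum the only printed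
bound is `exp(−Ω(n/4^d))` (Bourgain 2005; Green–Roy–Straubing 2005; Viola–Wigderson 2008 — the tree's
`GowersCube.violaWigderson_cube_exp_bound`), trivial from `d ≥ ½log₂ n + O(1)` on, and
Bhowmick–Lovett (CCC 2015, arXiv:1412.4719, Thms 3.1–3.2) show that it extends to, and is tight for,
nonclassical polynomials, which reach correlation `1 − ε` at degree `log₂((n+m)/ε) + O(1)`.  So an
EQUIDISTRIBUTION theorem at any rung `≥ 1` of the ladder would be a classical-specific correlation bound
beyond the log-degree barrier; the rungs `≥ 1` are therefore typed (and must be attacked) in the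
ONE-SIDED form `κ₀·#supp ≤ #class_r`, which implies no correlation bound.  The lemma is elementary; it
is recorded so that the ceiling of the equi form is a kernel statement rather than prose.
WHAT THIS IS NOT: no new bound on anything; nothing on α.

## References

* E. Viola, A. Wigderson, *Norms, XOR lemmas, and lower bounds for polynomials and protocols*,
  Theory of Computing 4 (2008), Thm. 2.9 [ViolaWigderson2008].
* A. Bhowmick, S. Lovett, *Nonclassical polynomials as a barrier to polynomial lower bounds*,
  CCC 2015 / arXiv:1412.4719, Thms 3.1–3.2 (the barrier; cited for context only).
-/

noncomputable section

namespace Summit.QuantumAdvantage.AdviceFreeQNC0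

open Finset
open Literature.Computability.MetaComplexity Literature.Computability.MetaComplexity.Smolensky
open Literature.Computability.MetaComplexity.Hegedus Literature.Computability.MetaComplexity.GowersCube

variable {n : ℕ}

/-- `𝔽₂ = {0, 1}`. [folklore] -/
private theorem zmod2_eq_zero_or_one (a : ZMod 2) : a = 0 ∨ a = 1 :=
  (by decide : ∀ a : ZMod 2, a = 0 ∨ a = 1) a

/-- The class decomposition of a support character sum:
`Σ_{u∈B} ω^{|u|} = Σ_{r<3} (#{u ∈ B : |u| ≡ r (3)} − #B/3)·ω^r` (using `1 + ω + ω² = 0`). [folklore] -/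
theorem sum_omega3_pow_wt_eq_sum_classes (B : Finset (Fin n → Bool)) :
    ∑ u ∈ B, omega3 ^ wt u =
      ∑ r ∈ range 3, ((((B.filter fun u => wt u % 3 = r % 3).card : ℝ) - (B.card : ℝ) / 3 : ℝ) : ℂ) *
        omega3 ^ r := by
  -- group the sum by `|u| mod 3`
  have hfib : ∑ u ∈ B, omega3 ^ wt u =
      ∑ r ∈ range 3, ((B.filter fun u => wt u % 3 = r % 3).card : ℂ) * omega3 ^ r := by
    rw [← sum_fiberwise_of_maps_to (s := B) (t := range 3) (g := fun u => wt u % 3)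
      (fun u _ => mem_range.2 (Nat.mod_lt _ (by norm_num)))]
    refine sum_congr rfl fun r hr => ?_
    have hr3 : r % 3 = r := Nat.mod_eq_of_lt (mem_range.1 hr)
    rw [show (B.filter fun u => wt u % 3 = r % 3) = B.filter fun u => wt u % 3 = r from
      filter_congr fun u _ => by rw [hr3]]
    rw [card_filter, Nat.cast_sum, sum_mul, sum_filter]
    refine sum_congr rfl fun u _ => ?_
    by_cases h : wt u % 3 = r
    · rw [if_pos h, if_pos h, Nat.cast_one, one_mul, omega3_pow_eq_pow_mod, h]
    · rw [if_neg h, if_neg h, Nat.cast_zero, zero_mul]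
  -- the constant part vanishes: `Σ_{r<3} (#B/3) ω^r = 0`
  have hzero : ∑ r ∈ range 3, (((B.card : ℝ) / 3 : ℝ) : ℂ) * omega3 ^ r = 0 := by
    rw [← mul_sum, Finset.sum_range_succ, Finset.sum_range_succ, Finset.sum_range_succ,
      Finset.sum_range_zero, zero_add, pow_zero, pow_one, one_add_omega3_add_sq, mul_zero]
  rw [hfib, ← sub_zero (∑ r ∈ range 3, ((B.filter fun u => wt u % 3 = r % 3).card : ℂ) * omega3 ^ r),
    ← hzero, ← sum_sub_distrib]
  refine sum_congr rfl fun r _ => ?_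
  push_cast
  ring

/-- **Balanced classes ⇒ small support character sum.** If `B` meets every class `|u| ≡ r (mod 3)` in
at least `(1/3 − ε)·#B` points then `‖Σ_{u∈B} ω^{|u|}‖ ≤ 6ε·#B`. [folklore] -/
theorem norm_sum_omega3_pow_le_of_balanced (B : Finset (Fin n → Bool)) {ε : ℝ}
    (hbal : ∀ r : ℕ, (1 / 3 - ε) * (B.card : ℝ) ≤ ((B.filter fun u => wt u % 3 = r % 3).card : ℝ)) :
    ‖∑ u ∈ B, omega3 ^ wt u‖ ≤ 6 * ε * B.card := by
  -- class counts
  set N : ℕ → ℝ := fun r => ((B.filter fun u => wt u % 3 = r % 3).card : ℝ) with hN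
  have hsum : N 0 + N 1 + N 2 = B.card := by
    have h := card_eq_sum_card_fiberwise (s := B) (t := range 3) (f := fun u => wt u % 3)
      (fun u _ => Finset.mem_coe.2 (mem_range.2 (Nat.mod_lt _ (by norm_num))))
    rw [Finset.sum_range_succ, Finset.sum_range_succ, Finset.sum_range_succ, Finset.sum_range_zero,
      zero_add] at h
    simp only [hN]
    have e0 : (B.filter fun u => wt u % 3 = 0 % 3) = B.filter fun u => wt u % 3 = 0 := rfl
    have e1 : (B.filter fun u => wt u % 3 = 1 % 3) = B.filter fun u => wt u % 3 = 1 := rfl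
    have e2 : (B.filter fun u => wt u % 3 = 2 % 3) = B.filter fun u => wt u % 3 = 2 := rfl
    rw [e0, e1, e2]
    exact_mod_cast h.symm
  -- two-sided deviation bounds from the one-sided hypothesis
  have hdev : ∀ r ∈ range 3, |N r - (B.card : ℝ) / 3| ≤ 2 * ε * B.card := by
    intro r hr
    have h0 := hbal 0
    have h1 := hbal 1
    have h2 := hbal 2
    simp only [hN] at h0 h1 h2 ⊢
    have hr' : r = 0 ∨ r = 1 ∨ r = 2 := by
      have := mem_range.1 hr
      omega
    rw [abs_le]
    rcases hr' with rfl | rfl | rfl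
    · constructor <;> linarith
    · constructor <;> linarith
    · constructor <;> linarith
  rw [sum_omega3_pow_wt_eq_sum_classes]
  calc ‖∑ r ∈ range 3, (((N r - (B.card : ℝ) / 3 : ℝ)) : ℂ) * omega3 ^ r‖
      ≤ ∑ r ∈ range 3, ‖(((N r - (B.card : ℝ) / 3 : ℝ)) : ℂ) * omega3 ^ r‖ := norm_sum_le _ _
    _ = ∑ r ∈ range 3, |N r - (B.card : ℝ) / 3| := by
        refine sum_congr rfl fun r _ => ?_
        rw [norm_mul, norm_pow, norm_omega3, one_pow, mul_one, Complex.norm_real, Real.norm_eq_abs]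
    _ ≤ ∑ _r ∈ range 3, 2 * ε * B.card := sum_le_sum hdev
    _ = 6 * ε * B.card := by rw [sum_const, card_range, nsmul_eq_mul]; push_cast; ring

/-- **Equidistribution at `(n, d)` ⇒ uniform MOD₃-character correlation bound at `(n, d)`** (the
ceiling of the equi form of the PLDAMS ladder): if every `g ∈ lowDeg 𝔽₂ n d` has `(1/3 − ε)`-balanced
support classes, then every `p ∈ lowDeg 𝔽₂ n d` satisfies `‖Σ_u (−1)^{p(u)} ω^{|u|}‖ ≤ 6ε·2ⁿ`.
The cell's bookkeeping (qa-qnc0, LIT-MEMO-11 §1); for context: printed bounds for this character sum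
stop at `d ≈ ½log₂ n` [cite: ViolaWigderson2008, Theorem 2.9]. -/
theorem norm_charSum_le_of_equidistributed {d : ℕ} {ε : ℝ}
    (hequi : ∀ g : CubeFn (ZMod 2) n, g ∈ lowDeg (ZMod 2) n d → ∀ r : ℕ,
      (1 / 3 - ε) * ((univ.filter fun u : Fin n → Bool => g u ≠ 0).card : ℝ) ≤
        ((univ.filter fun u : Fin n → Bool => g u ≠ 0 ∧ wt u % 3 = r % 3).card : ℝ))
    {p : CubeFn (ZMod 2) n} (hp : p ∈ lowDeg (ZMod 2) n d) :
    ‖∑ u : Fin n → Bool, signChar (p u) * omega3 ^ wt u‖ ≤ 6 * ε * (2 : ℝ) ^ n := by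
  classical
  set B1 : Finset (Fin n → Bool) := univ.filter fun u : Fin n → Bool => p u ≠ 0 with hB1
  set B0 : Finset (Fin n → Bool) := univ.filter fun u : Fin n → Bool => (1 + p) u ≠ 0 with hB0
  -- `(−1)^{p} = [p = 0] − [p ≠ 0]`, and `p u = 0 ↔ (1 + p) u ≠ 0` over `𝔽₂`
  have h01 : ∀ u : Fin n → Bool, (1 + p) u ≠ 0 ↔ p u = 0 := by
    intro u
    rw [Pi.add_apply, Pi.one_apply]
    rcases zmod2_eq_zero_or_one (p u) with h | h
    · rw [h]; simp
    · rw [h]; decide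
  have hsplit : ∑ u : Fin n → Bool, signChar (p u) * omega3 ^ wt u =
      ∑ u ∈ B0, omega3 ^ wt u - ∑ u ∈ B1, omega3 ^ wt u := by
    rw [hB0, hB1, sum_filter, sum_filter, ← sum_sub_distrib]
    refine sum_congr rfl fun u _ => ?_
    rcases zmod2_eq_zero_or_one (p u) with h | h
    · rw [if_pos ((h01 u).2 h), if_neg (by rw [h]; simp), h, signChar_zero]; ring
    · have hne : p u ≠ 0 := by rw [h]; exact one_ne_zero
      rw [if_neg (fun h' => hne ((h01 u).1 h')), if_pos hne, h, signChar_one]; ring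
  -- both supports are balanced
  have hbal1 : ∀ r : ℕ, (1 / 3 - ε) * (B1.card : ℝ) ≤ ((B1.filter fun u => wt u % 3 = r % 3).card : ℝ) := by
    intro r
    have h := hequi p hp r
    rw [hB1, filter_filter]
    exact h
  have hp1 : (1 + p) ∈ lowDeg (ZMod 2) n d := Submodule.add_mem _ (one_mem_lowDeg d) hp
  have hbal0 : ∀ r : ℕ, (1 / 3 - ε) * (B0.card : ℝ) ≤ ((B0.filter fun u => wt u % 3 = r % 3).card : ℝ) := by
    intro r
    have h := hequi (1 + p) hp1 r
    rw [hB0, filter_filter]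
    exact h
  have hn1 := norm_sum_omega3_pow_le_of_balanced B1 hbal1
  have hn0 := norm_sum_omega3_pow_le_of_balanced B0 hbal0
  -- the two supports partition the cube
  have hcard : (B0.card : ℝ) + B1.card = (2 : ℝ) ^ n := by
    have h := card_filter_add_card_filter_not (s := (univ : Finset (Fin n → Bool)))
      (fun u : Fin n → Bool => p u ≠ 0)
    have hB0' : B0 = univ.filter fun u : Fin n → Bool => ¬ (p u ≠ 0) :=
      filter_congr fun u _ => by rw [h01 u, not_not]
    rw [← hB0', ← hB1, card_univ, Fintype.card_fun, Fintype.card_bool, Fintype.card_fin] at h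
    rw [add_comm]
    exact_mod_cast h
  -- `ε ≥ ... ` is not needed: if `ε < 0` the hypothesis still yields the (then vacuous-looking) bound
  rw [hsplit]
  calc ‖∑ u ∈ B0, omega3 ^ wt u - ∑ u ∈ B1, omega3 ^ wt u‖
      ≤ ‖∑ u ∈ B0, omega3 ^ wt u‖ + ‖∑ u ∈ B1, omega3 ^ wt u‖ := norm_sub_le _ _
    _ ≤ 6 * ε * B0.card + 6 * ε * B1.card := add_le_add hn0 hn1
    _ = 6 * ε * (2 : ℝ) ^ n := by rw [← hcard]; ring

end Summit.QuantumAdvantage.AdviceFreeQNC0
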